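import Summits.QuantumFields.YangMills.Theorems.BalabanUVNodesN12ChartCurvatureOfClass
import Literature.MathematicalPhysics.QuantumFieldTheory.Balaban1983to89.Node00.MultiScaleFibreChartB
import Summits.QuantumFields.YangMills.Theorems.BalabanUVNodesN12ChartRegularityTowerProxiesB
import HarnessLib

/-!
# DAG node N12 [B15] — THE CHART CURVATURE (P5) OF A (2.12) MINIMISER FROM ITS CLASS, WITHOUT THE GLOBAL SMALL-BELOW LETTER (LOCATED-HSB pen ρ5c-(P5)): gauge covariance of — **BOND-DATUM EDITION** (`…N12ChartCurvatureOfClassB`, USED DECLARATIONS ONLY)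

The print-datum ([Balaban1984PropagatorsII] (2.3)) (γ) twin of `Summits/…/Theorems/BalabanUVNodesN12ChartCurvatureOfClass.lean`: the declarations of the parent whose STATEMENT reads the determining datum
(`msChart_gaugeAct_apply`, `towerGauges_Bj_of_mem_class`) and which N12's junction of record v14ᴸ uses (dag-n12-c g35 probe-2 census `UsedConstsN12RoadTyped2`, THEOREMS block), re-typed over a
BOND-LEVEL datum `𝔅 : BDetSet` (F0a `B15DeterminingSetsB`) and dag-n12-c's bond-datum chart `Node00.msChartB` (✓p774329; `msChart 𝐁 = msChartB (bondsDet 𝐁)` by `rfl`).  GENERATOR twin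
(this seat's `work/g32/gen_thm.py`, block-extracted from the parent's tree bytes): namespace `…N12ChartCurvatureOfClassB`, SAME short names, `DetSet ↦ BDetSet`, `AgreeOn 𝐁 ↦ AgreeOnB 𝔅`,
`IsMinimizer ↦ IsMinimizerB`, `bondsOf (𝐁 j) ↦ 𝔅 j`, `msChart ∕ constrCard ∕ constrEnum ∕ ConstrSet ↦ …B`, NODE 00 chart lemmas `…msChart… ↦ …msChartB…`; proofs VERBATIM; the parent's
datum-free declarations REUSED BY NAME (`open`), never copied (private plumbing excepted, №366 R2).  The parent's (b) statements are the instances `𝔅 := bondsDet 𝐁`.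

Cell `pub-ymgap` (HUMAN RULINGS D-0062 ∕ D-0149), seat `pub-ymgap-dag-n12-d` g32 (R134 N12 [B15] s2; the (ii) Theorems-side re-key of N12's road at print's [II] (2.3) datum — director-ym №338 ∕
№343 (E1)(iii-b), FLAG №16 ∕ ruling (α); dag-n12-c DESIGN memo a793b2ebc0b803bf (ii); `N12-ROAD-TWIN-ORDER-2026-08-30.md`).  Count-neutral helper of K1⁹ `stmt-QuantumFields-27364`,
`--kind proof --supports … --as helper`.  THEOREMS ONLY (0 `def`, 0 `instance`, 0 `sorry`).

HONEST FRAMING (director-ym №338 (5)).  PURELY ADDITIVE: the parent stays landed and true on its own text; nothing in it is edited; no displayed premise of any consumer is deleted or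
weakened; every hypothesis of the parent stays a hypothesis.  Nothing of Bałaban's analysis asserted; N12 NOT discharged; K0⁷ ∕ K1⁹ NOT closed; counts unmoved (typed 28∕28 · discharged
8∕27, A 8∕28; K 1∕4); one finite 𝕋⁴ programme at fixed ε — R4 closes the conditional rung `BalabanLadder.UV` only; NOT the Yang–Mills mass gap (Clay); nothing continuum ∕ ℝ⁴ ∕ OS.

PARENT's DOCSTRING (the mathematics and the citations; read the site-level `𝐁` as the bond datum `𝔅`):
# DAG node N12 [B15] — THE CHART CURVATURE (P5) OF A (2.12) MINIMISER FROM ITS CLASS, WITHOUT THE GLOBAL SMALL-BELOW LETTER (LOCATED-HSB pen ρ5c-(P5)): gauge covariance of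
# the canonical chart as a FUNCTION, second derivatives along a conjugation, per-bond GAUGES with near-flat cores from the class, and `‖D²Ψ_{U₀}(0)(w,w)‖ ≤ M₂‖w‖²`

[Balaban1985Variational] = «[15]», (2) p. 278, Sect. C (44)–(48) p. 285, (81)–(83) p. 290, (153) p. 301; [Balaban1988Convergent] = «[III]», (2.2) p. 255, (2.10)–(2.13) pp. 256–257;
[Balaban1985Averaging] = «[B-Av]», (8) (11) p. 19, (19) (21)–(23) p. 21; [Balaban1989LargeFieldII] (1.12) p. 359, (1.25) p. 362.

Cell `pub-ymgap`, HUMAN RULINGS D-0062 ∕ D-0149, lane owner `pub-ymgap-dag-n12-c` (g21).  Key K1⁹ `stmt-QuantumFields-27364`, `--kind proof --supports … --as helper`; count-neutral.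
NEW leaf; CONSUMED BY NAME, nothing modified: this lane's `N12TowerProxiesOfClass` (ρ5b: tower geometry, `gaugeAct_inv_gaugeAct_eq`, `chartLetters_msChart_Bj_of_isMinimizer_of_class`) and
`N12ChartRegularityTowerProxies` (ρ5a: `msChart_component_eq_of_towerProxy`), dag-n12-w6's `suProj_conj` ∕ `boxPlaqs_subset_plaqsOf_topSeq_pred` ∕ `exists_word_endpoints`, dag-n12-w4's
`Node00.expChart_gaugeAct` ∕ `fderiv_fderiv_apply_pi` ∕ `exists_uniform_chartCurvature_sq_bound` (its curvature conjunct is the displayed letter `hcurv` here), `B16Sect1Backgrounds.iter_gaugeAct`,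
`B7Prop6Flat.mlog_conj`, the tree's torus axial gauge `T4AxialGaugeSmallField`.

WHY.  After ρ5a–ρ5c the only `hsb`-consumers left on the direct road are (P4)′ (dag-n12-w6, box proxies) and (P5): p656421's `exists_chartCurvature_sq_bound_on_compact` bounds
`‖D²Ψ_{U₀}(0)(w,w)‖` on a compact set of SMALL-BELOW fields — at minimisers of data rough off `Z` that guard fails (LOCATED-HSB v2).  HERE the curvature of the chart at a (2.12)
minimiser is read off its CLASS: per constrained bond `(j,c)`, a gauge `u` whose transform of `U₀` flattened off the tower box is a globally `ρ″`-near-flat `V` (pure gauge on `Γ₀`, axial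
gauge at positive levels — ρ5b's construction, exported with its gauge); the `i`-th component of `Ψ_{W,U₀}` is the `i`-th component of the proxy chart (ρ5a §1), which is the conjugate
by `Ad((u↾_j)(c₊))` of the `i`-th component of the chart at `V` precomposed with the isometry `𝒜_u` (§1); second derivatives follow the conjugation (§2); so
`‖(D²Ψ_{U₀}(w,w))_i‖ = ‖(D²Ψ_V(𝒜w,𝒜w))_i‖ ≤ M₂‖w‖²` by w4's uniform curvature bound at the near-flat `V` — for EVERY component, hence for the sup norm.

CONTENTS (namespace `Summit.QuantumFields.YangMills.BalabanUVNodes.N12ChartCurvatureOfClass`; theorems only — no `def`, no `instance`, no `sorry`).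
* §1 `relAvg_gaugeAct`, ★★ `msChart_gaugeAct_apply` (function-level per-component covariance).
* §2 ★ `fderiv_fderiv_conj_apply` (calculus: `D²g(0)(Aw,Aw) = L(D²f(0)(w,w))` when `g ∘ A = L ∘ f`).
* §3 `gaugeAct_gaugeAct_inv`, ★★ `exists_boxGauge_of_plaqSmallOn`, ★★ `exists_towerGauge_of_mem_class_pos`, ★ `exists_towerGauge_zero`, ★★★ `towerGauges_Bj_of_mem_class` (per constrained
  bond: a gauge and a `ρ″`-near-flat core reproducing `U₀` on the tower).
* §4 ★★★ `norm_fderiv_fderiv_msChart_le_of_class` — THE (P5) LETTER `hM₂` FOR A (2.12) MINIMISER WITH NO `SmallBelow` HYPOTHESIS, displayed rows: `k+1 ≤ m+K`, `4L ≤ M₁`, the cube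
  divisibility, `0 ≤ εreg`, the per-height letters `hsbU` ∕ `hcurv` (both conjuncts of `Node00.exists_uniform_chartCurvature_sq_bound k`, before `ν`) and the floor `6(d−1)L·εreg ≤ ρ″`.

HONEST FRAMING ∕ LOCATED.  Kernel calculus + lattice bookkeeping over landed modules; `M₂`, `ρ″` are ∃-constants per height `(F, K, k)`; the (P5) consumers ((D1)′∕(E1)‴, the knit)
are NOT re-keyed here (dag-n12-d's v8); nothing of Bałaban's asserted; count-neutral helper; N12 NOT discharged; K1⁹ NOT closed; counts unmoved; one finite 𝕋⁴ programme at fixed ε —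
R4 closes the conditional finite-𝕋⁴ rung `BalabanLadder.UV` only; NOT continuum ∕ OS ∕ mass gap ∕ Clay.
-/

noncomputable section

open scoped BigOperators Matrix.Norms.L2Operator Topology
open Filter Finset

namespace Summit.QuantumFields.YangMills.BalabanUVNodes.N12ChartCurvatureOfClassB

open Literature.MathematicalPhysics.QuantumFieldTheory.Balaban1983to89.B15DeterminingSetsB

open Literature.MathematicalPhysics.QuantumFieldTheory.Balaban1983to89
open T4Continuum (T4Family walkEnd)
open T4AdjointCovarianceUnitary (lieSU specialUnitaryAd coe_specialUnitaryAd norm_specialUnitaryAd)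
open B15DeterminingSets
open B14.Eq213MaximalDomains (side)
open B14.Eq213DetSet (Bj Bj_of_gt Bj_mid Bj_top maxDomT)
open B14.Eq216Concrete (feeds inputs iter_local feeds_zero)
open B15Eq112TorusCover (lift cover cover_lift)
open T4AxialGaugeSmallField (castSite boxPlaqs boxBonds axialGauge dist1_gaugeAct_axialGauge_le_of_mem_boxBonds)
open B16Sect1Backgrounds (toMS iter_gaugeAct)
open T4ReflectionCone (three_le_L)
open Node00
open MatrixLog (mlog)
open Summit.QuantumFields.YangMills.BalabanUVNodes.N12GuardedLinAvgRightInverseGauge (suProj_conj)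
open Summit.QuantumFields.YangMills.BalabanUVNodes.N12ChartRegularityTowerProxiesB (msChart_component_eq_of_towerProxy)
open Summit.QuantumFields.YangMills.BalabanUVNodes.N12WindowNearRegionGeometry (boxPlaqs_subset_plaqsOf_topSeq_pred exists_word_endpoints)
open Summit.QuantumFields.YangMills.BalabanUVNodes.N12TowerProxiesOfClass (towerBox_lt_sitesPerDir boxSide_mul_eta_sq_le gaugeAct_inv_gaugeAct_eq shift_ne_self feeds_subset_boxBonds
  chartLetters_msChart_Bj_of_isMinimizer_of_class)
open Summit.QuantumFields.YangMills.BalabanUVNodes.N12ChartCurvatureOfClass (exists_towerGauge_of_mem_class_pos exists_towerGauge_zero relAvg_gaugeAct)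

section
variable {F : T4Family} {N : ℕ} [NeZero N] {K k : ℕ}

/-- ★★ **THE CHART IS GAUGE COVARIANT, COMPONENT BY COMPONENT, AS A FUNCTION**: `Ψ_{𝐁,W^u,U^u}(𝒜_u X) i = Ad((u↾_j)(c_{i,+})) (Ψ_{𝐁,W,U}(X) i)` for EVERY `X` — the function-level
statement behind dag-n12-w6's first-derivative covariance `fderiv_msChart_gaugeAct_apply` (logarithm and `𝔰𝔲`-projection commute with conjugation: `B7Prop6Flat.mlog_conj`, `suProj_conj`).
[cite: Balaban1985Variational, (47)–(48) p.285, (153) p.301; Balaban1985Averaging, (11) p.19, (21)–(23) p.21; Balaban1989LargeFieldII, (1.25) p.362] -/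
theorem msChart_gaugeAct_apply (hk : k ≤ (F.P K).m + (F.P K).K) {𝔅 : BDetSet (F.P K)} (u : GaugeTransf (F.P K) 0 (SU N)) (W : MSField (F.P K) (SU N))
    (U : GaugeField (F.P K) 0 (SU N)) (X : PBond (F.P K) 0 → lieSU (Fin N)) (i : Fin (constrCardB 𝔅 k)) :
    msChartB F N K k 𝔅 (fun j c => toMS u j c.src * W j c * (toMS u j c.tgt)⁻¹) (GaugeField.gaugeAct u U) (fun b => specialUnitaryAd (u b.tgt) (X b)) i
      = specialUnitaryAd (toMS u (((constrEnumB 𝔅 k).symm i).1 : ℕ) ((constrEnumB 𝔅 k).symm i).2.1.tgt) (msChartB F N K k 𝔅 W U X i) := by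
  have hj : (((constrEnumB 𝔅 k).symm i).1 : ℕ) ≤ k := Nat.le_of_lt_succ ((constrEnumB 𝔅 k).symm i).1.2
  rw [msChartB_apply, msChartB_apply, relAvg_gaugeAct hk u W U X hj]
  set b : SU N := toMS u (((constrEnumB 𝔅 k).symm i).1 : ℕ) ((constrEnumB 𝔅 k).symm i).2.1.tgt
  set R : Matrix (Fin N) (Fin N) ℂ := relAvg K W (expChart U X) (((constrEnumB 𝔅 k).symm i).1 : ℕ) ((constrEnumB 𝔅 k).symm i).2.1
  -- `log (b R b*) = b (log R) b*` (conjugation commutes with the logarithmic series) and `π (b M b*) = Ad b (π M)`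
  let ub : (Matrix (Fin N) (Fin N) ℂ)ˣ := ⟨(b : Matrix (Fin N) (Fin N) ℂ), star (b : Matrix (Fin N) (Fin N) ℂ), coe_mul_star_coe_SU b, star_coe_mul_coe_SU b⟩
  have hlog : mlog (((b : SU N) : Matrix (Fin N) (Fin N) ℂ) * R * star ((b : SU N) : Matrix (Fin N) (Fin N) ℂ))
      = ((b : SU N) : Matrix (Fin N) (Fin N) ℂ) * mlog R * star ((b : SU N) : Matrix (Fin N) (Fin N) ℂ) :=
    B7Prop6Flat.mlog_conj ub R
  rw [hlog, suProj_conj]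

end

section
variable {F : T4Family} {N : ℕ} [NeZero N] {K k : ℕ}

/-- ★★★ **PER CONSTRAINED BOND OF `𝐁_k(Z)`: A GAUGE AND A NEAR-FLAT CORE REPRODUCING `U₀` ON THE TOWER**, from class membership (`k+1 ≤ m+K`, `4L ≤ M₁`, cube divisibility, `0 ≤ εreg`).
[cite: Balaban1985Variational, (2) p.278; Balaban1988Convergent, (2.2) p.255, (2.11)–(2.13) pp.256–257] -/
theorem towerGauges_lamBondsSeq_of_mem_class (ν : Stage7Numerics) (Kt : ℕ) {k : ℕ} (Z : Set (Site (F.P Kt) 0))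
    (hkK : k + 1 ≤ (F.P Kt).m + (F.P Kt).K) (hM4 : 4 * (F.P Kt).L ≤ ν.M₁) (hdiv : side (F.P Kt).L ν.M₁ k ∣ (F.P Kt).sitesPerDir 0)
    (hε : 0 ≤ ν.εreg) {U₀ : GaugeField (F.P Kt) 0 (SU N)} (hU₀ : U₀ ∈ regMSCoPOfRecord F N ν Kt k (maxDomT ν.M₁ Z))
    (i : Fin (constrCardB (lamBondsSeq (maxDomT ν.M₁ Z) k) k)) :
    ∃ (u : GaugeTransf (F.P Kt) 0 (SU N)) (V : GaugeField (F.P Kt) 0 (SU N)),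
      ‖coeField V - 1‖ ≤ 6 * ((((F.P Kt).d - 1 : ℕ)) : ℝ) * (F.P Kt).L * ν.εreg ∧
      ∀ b ∈ feeds (((constrEnumB (lamBondsSeq (maxDomT ν.M₁ Z) k) k).symm i).1 : ℕ) ((constrEnumB (lamBondsSeq (maxDomT ν.M₁ Z) k) k).symm i).2.1,
        GaugeField.gaugeAct (fun s => (u s)⁻¹ : GaugeTransf (F.P Kt) 0 (SU N)) V b = U₀ b := by
  have key : ∀ j, j ≤ k → ∀ c : PBond (F.P Kt) j, c ∈ bondsOf (Bj ν.M₁ Z k j) →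
      ∃ (u : GaugeTransf (F.P Kt) 0 (SU N)) (V : GaugeField (F.P Kt) 0 (SU N)),
        ‖coeField V - 1‖ ≤ 6 * ((((F.P Kt).d - 1 : ℕ)) : ℝ) * (F.P Kt).L * ν.εreg ∧
        ∀ b ∈ feeds j c, GaugeField.gaugeAct (fun s => (u s)⁻¹ : GaugeTransf (F.P Kt) 0 (SU N)) V b = U₀ b := by
    intro j hj c hc
    rcases Nat.eq_zero_or_pos j with rfl | hj1
    · exact exists_towerGauge_zero (by have := three_le_L (F.P Kt); positivity) U₀ c
    · exact exists_towerGauge_of_mem_class_pos ν Kt Z hkK hM4 hdiv hε hU₀ hj1 hj hc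
  exact key _ (Nat.le_of_lt_succ ((constrEnumB (lamBondsSeq (maxDomT ν.M₁ Z) k) k).symm i).1.2) _ (lamBondsSeq_subset_bondsOf_genSet _ _ _ ((constrEnumB (lamBondsSeq (maxDomT ν.M₁ Z) k) k).symm i).2.2)

end

end Summit.QuantumFields.YangMills.BalabanUVNodes.N12ChartCurvatureOfClassB

end
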